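import Summits.CriticalPhenomena.Ising3DConformalLimit.Theses.MonotoneBlocking
import Summits.CriticalPhenomena.Ising3DConformalLimit.Theses.GaussianScaleMixture
import HarnessLib

/-!
# Sketch — crux `MonotoneBlockingTwo` (stmt-CriticalPhenomena-17054), crux-ideate round 1, ideator 2

Idea `clock-tilt`: under the Gaussian-scale-mixture representation of the critical two-point function
(crux `CriticalTwoPointGSM`, stmt-8365) every block covariance is an EXACT clock integral of a product of
three one-dimensional "clock tents", blocking acts on the clock law by an explicit tilt, and the offset `k`
disappears from the monotonicity problem. First lemmas typed here; nothing is proposed to the tree.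
-/

noncomputable section

namespace Summit.CriticalPhenomena.Ising3DConformalLimit.Cruxes.MonotoneBlockingTwo.ClockTilt

open MeasureTheory Finset
open scoped BigOperators ENNReal
open Literature.Probability.LatticeModels
open Summit.CriticalPhenomena.Ising3DConformalLimit.Theses.MonotoneBlocking (MonotoneBlockingTwo)
open Summit.CriticalPhenomena.Ising3DConformalLimit.Theses.GaussianScaleMixture (CriticalTwoPointGSM)

/-! ## §0 The crux as the BM₂ shape of a kernel (definitional bridge, as in the strategist sketch) -/

/-- The cube `[0,L)³`. -/
def cube (L : ℕ) : Finset (Site 3) := Fintype.piFinset fun _ : Fin 3 => Finset.Ico (0 : ℤ) (L : ℤ)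

/-- Block covariance functional `bc_G(L,k) = Σ_{x,y ∈ [0,L)³} G(Lk + x − y)`. -/
def bcOf (G : Site 3 → ℝ) (L : ℕ) (k : Site 3) : ℝ :=
  ∑ x ∈ cube L, ∑ y ∈ cube L, G ((L : ℤ) • k + x - y)

/-- BM₂ shape of a kernel. -/
def BM2Of (G : Site 3 → ℝ) : Prop :=
  ∀ L : ℕ, 1 ≤ L → ∀ k : Site 3, bcOf G L k * bcOf G (L + 1) 0 ≤ bcOf G (L + 1) k * bcOf G L 0

theorem monotoneBlockingTwo_iff : MonotoneBlockingTwo ↔ BM2Of (criticalTwoPoint 3) := Iff.rfl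

/-! ## §1 Clock laws and the exact tilt identity (FIRST LEMMA of the line) -/

/-- `G` is the Gaussian scale mixture of the clock law `ν` on `[0,∞)³` (the representation clause of
`CriticalTwoPointGSM`, for an arbitrary kernel). -/
def IsClockLaw (G : Site 3 → ℝ) (ν : Measure (Fin 3 → ℝ)) : Prop :=
  IsProbabilityMeasure ν ∧ ν {s | ∃ i, s i < 0} = 0 ∧
    ∀ x : Site 3, G x = ∫ s, Real.exp (-∑ i, s i * ((x i : ℝ)) ^ 2) ∂ν

/-- The crux kernel has a clock law (immediate from `CriticalTwoPointGSM`). -/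
theorem isClockLaw_of_gsm (h : CriticalTwoPointGSM) : ∃ ν, IsClockLaw (criticalTwoPoint 3) ν := by
  obtain ⟨ν, hp, hsupp, _hex, hrep⟩ := h
  exact ⟨ν, hp, hsupp, hrep⟩

/-- One-dimensional CLOCK TENT `T_L(s,κ) = Σ_{a,b ∈ [0,L)} exp(−s (Lκ + a − b)²)`: the block covariance at
block-offset `κ` of the 1D Gaussian kernel `n ↦ e^{−s n²}`. -/
def clockTent (L : ℕ) (s : ℝ) (κ : ℤ) : ℝ :=
  ∑ a ∈ Finset.range L, ∑ b ∈ Finset.range L, Real.exp (-(s * ((L : ℝ) * κ + a - b) ^ 2))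

/-- FIRST LEMMA (exact tilt identity, Fubini on finite sums): for a clock law, every block covariance is a
clock integral of a PRODUCT of three 1D tents — the offset enters coordinatewise. -/
def ClockBlockIdentity : Prop :=
  ∀ (G : Site 3 → ℝ) (ν : Measure (Fin 3 → ℝ)), IsClockLaw G ν →
    ∀ (L : ℕ) (k : Site 3), bcOf G L k = ∫ s, ∏ i, clockTent L (s i) (k i) ∂ν

/-- Normalised 1D block profile `τ_L(s,κ) = T_L(s,κ)/T_L(s,0) ∈ [0,1]`. -/
def clockRatio (L : ℕ) (s : ℝ) (κ : ℤ) : ℝ := clockTent L s κ / clockTent L s 0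

/-- 1D LEMMA (checked numerically, L ≤ 13, κ ≤ 3): `s ↦ τ_L(s,κ)` is antitone on `[0,∞)` for `κ ≠ 0`
(slower clocks correlate distant blocks more). -/
def ClockRatioAntitone : Prop :=
  ∀ L : ℕ, 1 ≤ L → ∀ κ : ℤ, κ ≠ 0 → AntitoneOn (fun s : ℝ => clockRatio L s κ) (Set.Ici 0)

/-- The level-`L` TILTED clock law `ν_L(ds) ∝ Π_i T_L(s_i,0) ν(ds)` (unnormalised): by the identity,
`ρ(L;k) = E_{ν_L}[Π_i τ_L(s_i,k_i)]`, so BM₂ is a comparison between CONSECUTIVE TILTS of one measure. -/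
def tilt (ν : Measure (Fin 3 → ℝ)) (L : ℕ) : Measure (Fin 3 → ℝ) :=
  ν.withDensity fun s => ENNReal.ofReal (∏ i, clockTent L (s i) 0)

/-! ## §2 The k-free core C⁺ (idealised form) and the transfer -/

/-- C⁺ (IDEALISED, k-free): consecutive tilts are ordered in the LOWER-ORTHANT order after a monotone
one-dimensional "dilation compensator" `φ_L ≈ s (L/(L+1))²` that matches the 1D profiles
(`τ_L(s,κ) ≤ τ_{L+1}(φ_L s, κ)` for all `κ ≠ 0`). For the pure scaling clock law this is an equality; for
the lattice law it must be ε-relaxed at the ultraviolet atoms (card §Barriers) — the crux-plan seat types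
the budgeted version. -/
def ClockDominance (ν : Measure (Fin 3 → ℝ)) : Prop :=
  ∀ L : ℕ, 1 ≤ L → ∃ φ : ℝ → ℝ, Monotone φ ∧
    (∀ κ : ℤ, κ ≠ 0 → ∀ s : ℝ, 0 ≤ s → clockRatio L s κ ≤ clockRatio (L + 1) (φ s) κ) ∧
    ∀ a : Fin 3 → ℝ,
      tilt ν (L + 1) Set.univ * tilt ν L {s | ∀ i, φ (s i) ≤ a i} ≤
        tilt ν L Set.univ * tilt ν (L + 1) {s | ∀ i, s i ≤ a i}

/-- TRANSFER (provable analysis: products of antitone `[0,1]`-valued functions are mixtures of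
lower-orthant indicators, so their tilted expectations are monotone in the lower-orthant order):
identity + 1D antitonicity + dominance ⟹ the BM₂ shape. -/
def ClockTransfer : Prop :=
  ClockBlockIdentity → ClockRatioAntitone →
    ∀ (G : Site 3 → ℝ) (ν : Measure (Fin 3 → ℝ)), IsClockLaw G ν → ClockDominance ν → BM2Of G

/-- Composition through the `Iff.rfl` bridge (kernel-checked modus ponens): GSM + the three pieces +
dominance of the critical clock law ⟹ the crux. -/
theorem bm2_of_clockTilt (hG : CriticalTwoPointGSM) (hId : ClockBlockIdentity) (hA : ClockRatioAntitone)
    (hT : ClockTransfer) (hD : ∀ ν, IsClockLaw (criticalTwoPoint 3) ν → ClockDominance ν) :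
    MonotoneBlockingTwo := by
  obtain ⟨ν, hν⟩ := isClockLaw_of_gsm hG
  exact monotoneBlockingTwo_iff.2 (hT hId hA _ ν hν (hD ν hν))

/-! ## §3 The punctured-kernel lemma (the on-site atom only helps; provable, UV-budget support) -/

/-- Remove the on-site value: `G°(0) = 0`, `G° = G` elsewhere. -/
def punctured (G : Site 3 → ℝ) : Site 3 → ℝ := fun x => if x = 0 then 0 else G x

/-- SUPPORT LEMMA (elementary): blocks at offset `k ≠ 0` are disjoint, so `bc_G(L,k) = bc_{G°}(L,k)`, while
`bc_G(L,0) = bc_{G°}(L,0) + G(0)L³` and `bc_{G°}(L,0)/L³` is non-decreasing in `L` for `G ≥ 0`; hence the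
BM₂ shape of the punctured kernel implies that of `G` (the Kronecker atom is a pure, sign-definite gain). -/
def PuncturedTransfer : Prop :=
  ∀ G : Site 3 → ℝ, (∀ x, 0 ≤ G x) → BM2Of (punctured G) → BM2Of G

end Summit.CriticalPhenomena.Ising3DConformalLimit.Cruxes.MonotoneBlockingTwo.ClockTilt

end
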